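import Mathlib
import Summits.CriticalPhenomena.Ising3DConformalLimit.Theorems.PrecisionLaplacianEtaBoundsTransferTrig
import Literature.Probability.LatticeModels.SharpnessProofs
import HarnessLib

/-!
# Stub `stub_shiftedBoxWeightLower` of line `diffusive-branch-is-nonsaturation` (crux
# `PrecisionLaplacian.DirectCorrelationStableTail`, stmt-CriticalPhenomena-4799): Dirichlet-kernel
# lower bound for the Fourier weight of the shifted-box test vector

**Statement** (registered text, = `stub_shiftedBoxWeightLower` of the lead's skeleton).  For the
shifted-box test vector `v = 𝟙_{Λ_R} − 𝟙_{Λ_R + y}` on `S = Λ_R ∪ (Λ_R + y)` (`Λ_R = box 3 R`,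
`v x = [x ∈ Λ_R] − [x − y ∈ Λ_R]`), `R ≥ 1`, `‖y‖∞ ≤ R` and `|k_j| ≤ 1/(2R+1)`:
`Σ_{x,x' ∈ S} v_x v_{x'} cos(k·(x' − x)) ≥ ((2R+1)⁶/64) · (2/5) (k·y)²`.

**Proof** (pure trigonometry, Ising-free).
* `Σ_{x,x'} v_x v_{x'} cos(θ_{x'} − θ_x) = (Σ v cos θ)² + (Σ v sin θ)²`
  (`shiftedBoxWeight_sum_sum_mul_mul_cos_sub`), and the weighted sums over `S` split into the
  `Λ_R`-part and the `(Λ_R + y)`-part (`shiftedBoxWeight_sum_indicator_mul`); with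
  `Σ_{Λ_R} cos k·b = ψ := ∏_j D_R(k_j)` and `Σ_{Λ_R} sin k·b = 0` (tree: `sum_box_cos_phase`,
  `sum_box_sin_phase`) this gives the identity `Σ_{x,x'} … = 2 ψ² (1 − cos k·y)`
  (`shiftedBoxWeight_eq`).
* `D_R(t) ≥ (2R+1)/2` for `|t| ≤ 1/(2R+1)` (each `cos(m t) ≥ 1 − 1/8`), so `ψ² ≥ (2R+1)⁶/64`.
* `|k·y| ≤ 3R/(2R+1) ≤ 3/2 < π` and Jordan/Kober `1 − cos θ ≥ 2θ²/π² ≥ θ²/5`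
  (`Real.cos_le_one_sub_mul_cos_sq`, `π < 3.15`).

Pure theorem file, no definitions, no `sorry`.  References: folklore (Dirichlet kernel, Kober's
inequality).
-/

noncomputable section

namespace Summit.CriticalPhenomena.Ising3DConformalLimit.Cruxes.DirectCorrelationStableTail.DiffusiveBranchIsNonsaturation

open Finset
open scoped BigOperators
open Literature.Probability.LatticeModels
open Literature.Barriers.CriticalPhenomena.SpreadOutIsing (dirichletRowSum)
open Summit.CriticalPhenomena.Ising3DConformalLimit.Theorems.EtaBoundsTransfer
  (sum_box_cos_phase sum_box_sin_phase)

/-! ### Step 1: the weighted `cos/sin` identity and the indicator bookkeeping on `S` -/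

/-- Weighted version of `(Σ cos θ)² + (Σ sin θ)² = ΣΣ cos(θ' − θ)`:
`Σ_{x,x'} w_x w_{x'} cos(θ_{x'} − θ_x) = (Σ w cos θ)² + (Σ w sin θ)²`. [folklore] -/
theorem shiftedBoxWeight_sum_sum_mul_mul_cos_sub {ι : Type*} (s : Finset ι) (w θ : ι → ℝ) :
    ∑ x ∈ s, ∑ x' ∈ s, w x * w x' * Real.cos (θ x' - θ x)
      = (∑ x ∈ s, w x * Real.cos (θ x)) ^ 2 + (∑ x ∈ s, w x * Real.sin (θ x)) ^ 2 := by
  simp_rw [Real.cos_sub]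
  rw [sq, sq, Finset.sum_mul_sum, Finset.sum_mul_sum, ← Finset.sum_add_distrib]
  refine Finset.sum_congr rfl fun x _ => ?_
  rw [← Finset.sum_add_distrib]
  refine Finset.sum_congr rfl fun x' _ => ?_
  ring

/-- On `S = B ∪ (B + y)`, summing against the indicator of `B` restricts to `B`. [folklore] -/
theorem shiftedBoxWeight_sum_boole_mem_mul {α : Type*} [DecidableEq α] (B T : Finset α)
    (F : α → ℝ) :
    ∑ x ∈ B ∪ T, (if x ∈ B then (1 : ℝ) else 0) * F x = ∑ x ∈ B, F x := by
  simp_rw [boole_mul]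
  rw [Finset.sum_ite_mem, Finset.union_inter_cancel_left]

/-- On `S = B ∪ (B + y)`, summing against the indicator of `B + y` (written `x − y ∈ B`) is the
sum over `B` of the translate. [folklore] -/
theorem shiftedBoxWeight_sum_boole_sub_mem_mul {α : Type*} [DecidableEq α] [AddCommGroup α]
    (B : Finset α) (y : α) (F : α → ℝ) :
    ∑ x ∈ B ∪ B.image (· + y), (if x - y ∈ B then (1 : ℝ) else 0) * F x
      = ∑ b ∈ B, F (b + y) := by
  simp_rw [boole_mul]
  rw [← Finset.sum_filter]
  have hS : (B ∪ B.image (· + y)).filter (fun x => x - y ∈ B) = B.image (· + y) := by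
    ext x
    simp only [Finset.mem_filter, Finset.mem_union, Finset.mem_image]
    constructor
    · rintro ⟨-, hx⟩
      exact ⟨x - y, hx, sub_add_cancel x y⟩
    · rintro ⟨b, hb, rfl⟩
      exact ⟨Or.inr ⟨b, hb, rfl⟩, by simpa using hb⟩
  rw [hS, Finset.sum_image fun a _ b _ h => add_right_cancel h]

/-- The shifted-box weight `v x = [x ∈ B] − [x − y ∈ B]` summed against `F` over
`S = B ∪ (B + y)`: `Σ_S v F = Σ_B F − Σ_B F(· + y)`. [folklore] -/
theorem shiftedBoxWeight_sum_indicator_mul {α : Type*} [DecidableEq α] [AddCommGroup α]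
    (B : Finset α) (y : α) (F : α → ℝ) :
    ∑ x ∈ B ∪ B.image (· + y),
        ((if x ∈ B then (1 : ℝ) else 0) - (if x - y ∈ B then (1 : ℝ) else 0)) * F x
      = ∑ b ∈ B, F b - ∑ b ∈ B, F (b + y) := by
  simp_rw [sub_mul]
  rw [Finset.sum_sub_distrib, shiftedBoxWeight_sum_boole_mem_mul,
    shiftedBoxWeight_sum_boole_sub_mem_mul]

variable {d : ℕ}

/-- Translated cosine sum over a box: `Σ_{b ∈ Λ_L} cos k·(b + y) = cos(k·y) ∏_j D_L(k_j)`.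
[folklore] -/
theorem shiftedBoxWeight_sum_box_cos_phase_add (L : ℕ) (k : Fin d → ℝ) (y : Site d) :
    ∑ b ∈ box d L, Real.cos (phase d k (b + y))
      = Real.cos (phase d k y) * ∏ j, dirichletRowSum L (k j) := by
  simp_rw [phase_add, Real.cos_add]
  rw [Finset.sum_sub_distrib, ← Finset.sum_mul, ← Finset.sum_mul, sum_box_cos_phase,
    sum_box_sin_phase]
  ring

/-- Translated sine sum over a box: `Σ_{b ∈ Λ_L} sin k·(b + y) = sin(k·y) ∏_j D_L(k_j)`.
[folklore] -/
theorem shiftedBoxWeight_sum_box_sin_phase_add (L : ℕ) (k : Fin d → ℝ) (y : Site d) :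
    ∑ b ∈ box d L, Real.sin (phase d k (b + y))
      = Real.sin (phase d k y) * ∏ j, dirichletRowSum L (k j) := by
  simp_rw [phase_add, Real.sin_add]
  rw [Finset.sum_add_distrib, ← Finset.sum_mul, ← Finset.sum_mul, sum_box_cos_phase,
    sum_box_sin_phase]
  ring

/-- **The Fourier weight of the shifted-box vector**: for `v = 𝟙_{Λ_R} − 𝟙_{Λ_R + y}` on
`S = Λ_R ∪ (Λ_R + y)`, `Σ_{x,x' ∈ S} v_x v_{x'} cos k·(x' − x) = 2 (∏_j D_R(k_j))² (1 − cos k·y)`.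
[folklore] -/
theorem shiftedBoxWeight_eq (R : ℕ) (y : Site d) (k : Fin d → ℝ) :
    ∑ x ∈ (box d R ∪ (box d R).image (· + y)), ∑ x' ∈ (box d R ∪ (box d R).image (· + y)),
        ((if x ∈ box d R then (1 : ℝ) else 0) - (if x - y ∈ box d R then (1 : ℝ) else 0)) *
          ((if x' ∈ box d R then (1 : ℝ) else 0) - (if x' - y ∈ box d R then (1 : ℝ) else 0)) *
          Real.cos (phase d k (x' - x))
      = 2 * (∏ j, dirichletRowSum R (k j)) ^ 2 * (1 - Real.cos (phase d k y)) := by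
  simp_rw [phase_sub]
  rw [shiftedBoxWeight_sum_sum_mul_mul_cos_sub (box d R ∪ (box d R).image (· + y))
      (fun x => (if x ∈ box d R then (1 : ℝ) else 0) - (if x - y ∈ box d R then (1 : ℝ) else 0))
      (phase d k),
    shiftedBoxWeight_sum_indicator_mul (box d R) y (fun x => Real.cos (phase d k x)),
    shiftedBoxWeight_sum_indicator_mul (box d R) y (fun x => Real.sin (phase d k x)),
    sum_box_cos_phase, sum_box_sin_phase, shiftedBoxWeight_sum_box_cos_phase_add,
    shiftedBoxWeight_sum_box_sin_phase_add]
  linear_combination (∏ j, dirichletRowSum R (k j)) ^ 2 * Real.sin_sq_add_cos_sq (phase d k y)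

/-! ### Step 2: the Dirichlet kernel on the small cube `|k_j| ≤ 1/(2R+1)` -/

/-- For `|t| ≤ 1/(2R+1)` every term of `D_R(t) = Σ_{|m| ≤ R} cos(m t)` is `≥ 7/8 ≥ 1/2`, so
`D_R(t) ≥ (2R+1)/2`. [folklore] -/
theorem shiftedBoxWeight_half_le_dirichletRowSum (R : ℕ) {t : ℝ}
    (ht : |t| ≤ 1 / (2 * (R : ℝ) + 1)) : (2 * (R : ℝ) + 1) / 2 ≤ dirichletRowSum R t := by
  unfold dirichletRowSum
  have hR : (0 : ℝ) < 2 * R + 1 := by positivity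
  have hterm : ∀ m ∈ Finset.Icc (-(R : ℤ)) R, (1 / 2 : ℝ) ≤ Real.cos (m * t) := by
    intro m hm
    rw [Finset.mem_Icc] at hm
    have hmabs : |(m : ℝ)| ≤ R := by
      rw [← Int.cast_abs]; exact_mod_cast abs_le.2 ⟨hm.1, hm.2⟩
    have hu : |(m : ℝ) * t| ≤ 1 / 2 := by
      rw [abs_mul]
      calc |(m : ℝ)| * |t| ≤ R * (1 / (2 * (R : ℝ) + 1)) :=
            mul_le_mul hmabs ht (abs_nonneg t) (Nat.cast_nonneg R)
        _ ≤ 1 / 2 := by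
            rw [mul_one_div, div_le_div_iff₀ hR two_pos]; linarith
    have h := Real.one_sub_sq_div_two_le_cos (x := (m : ℝ) * t)
    have hsq : ((m : ℝ) * t) ^ 2 ≤ (1 / 2) ^ 2 := by
      rw [← sq_abs]; exact pow_le_pow_left₀ (abs_nonneg _) hu 2
    linarith
  calc (2 * (R : ℝ) + 1) / 2 = ∑ _m ∈ Finset.Icc (-(R : ℤ)) R, (1 / 2 : ℝ) := by
        rw [Finset.sum_const, Int.card_Icc, nsmul_eq_mul,
          show (R : ℤ) + 1 - -(R : ℤ) = ((2 * R + 1 : ℕ) : ℤ) by push_cast; ring, Int.toNat_natCast]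
        push_cast; ring
    _ ≤ ∑ m ∈ Finset.Icc (-(R : ℤ)) R, Real.cos (m * t) := Finset.sum_le_sum hterm

/-- On the small cube `|k_j| ≤ 1/(2R+1)`: `(∏_j D_R(k_j))² ≥ ((2R+1)/2)⁶ = (2R+1)⁶/64`.
[folklore] -/
theorem shiftedBoxWeight_prod_dirichletRowSum_sq_ge (R : ℕ) {k : Fin 3 → ℝ}
    (hk : ∀ j, |k j| ≤ 1 / (2 * (R : ℝ) + 1)) :
    (2 * (R : ℝ) + 1) ^ 6 / 64 ≤ (∏ j : Fin 3, dirichletRowSum R (k j)) ^ 2 := by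
  have hR : (0 : ℝ) ≤ (2 * R + 1) / 2 := by positivity
  have hprod : ((2 * (R : ℝ) + 1) / 2) ^ 3 ≤ ∏ j : Fin 3, dirichletRowSum R (k j) := by
    calc ((2 * (R : ℝ) + 1) / 2) ^ 3 = ∏ _j : Fin 3, (2 * (R : ℝ) + 1) / 2 := by
          rw [Finset.prod_const, Finset.card_univ, Fintype.card_fin]
      _ ≤ ∏ j : Fin 3, dirichletRowSum R (k j) :=
          Finset.prod_le_prod (fun _ _ => hR) fun j _ =>
            shiftedBoxWeight_half_le_dirichletRowSum R (hk j)
  calc (2 * (R : ℝ) + 1) ^ 6 / 64 = (((2 * (R : ℝ) + 1) / 2) ^ 3) ^ 2 := by ring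
    _ ≤ (∏ j : Fin 3, dirichletRowSum R (k j)) ^ 2 := pow_le_pow_left₀ (by positivity) hprod 2

/-! ### Step 3: `|k·y| ≤ 3/2` and Kober's inequality -/

/-- For `‖y‖∞ ≤ R` and `|k_j| ≤ 1/(2R+1)`: `|k·y| ≤ 3R/(2R+1) ≤ 3/2`. [folklore] -/
theorem shiftedBoxWeight_abs_phase_le (R : ℕ) {y : Site 3} {k : Fin 3 → ℝ}
    (hy : Site.supNorm y ≤ R) (hk : ∀ j, |k j| ≤ 1 / (2 * (R : ℝ) + 1)) :
    |phase 3 k y| ≤ 3 / 2 := by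
  have hR : (0 : ℝ) < 2 * R + 1 := by positivity
  have hyi : ∀ i, |((y i : ℤ) : ℝ)| ≤ R := by
    intro i
    have h1 : (y i).natAbs ≤ R := (Site.natAbs_le_supNorm y i).trans hy
    have h2 : |y i| ≤ (R : ℤ) := by rw [abs_le]; omega
    rw [← Int.cast_abs]; exact_mod_cast h2
  unfold phase
  calc |∑ i, k i * (y i : ℝ)| ≤ ∑ i, |k i * (y i : ℝ)| := Finset.abs_sum_le_sum_abs _ _
    _ ≤ ∑ _i : Fin 3, 1 / (2 * (R : ℝ) + 1) * R := Finset.sum_le_sum fun i _ => by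
        rw [abs_mul]; exact mul_le_mul (hk i) (hyi i) (abs_nonneg _) (by positivity)
    _ = 3 * ((R : ℝ) / (2 * R + 1)) := by
        rw [Finset.sum_const, Finset.card_univ, Fintype.card_fin, nsmul_eq_mul]
        push_cast; ring
    _ ≤ 3 / 2 := by
        have : (R : ℝ) / (2 * R + 1) ≤ 1 / 2 := by
          rw [div_le_div_iff₀ hR two_pos]; linarith
        linarith

/-- Kober/Jordan: `1 − cos θ ≥ 2θ²/π² ≥ θ²/5` for `|θ| ≤ 3/2` (`π² < 10`). [folklore] -/
theorem shiftedBoxWeight_sq_div_five_le_one_sub_cos {θ : ℝ} (hθ : |θ| ≤ 3 / 2) :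
    θ ^ 2 / 5 ≤ 1 - Real.cos θ := by
  have hπ3 := Real.pi_gt_three
  have hθπ : |θ| ≤ Real.pi := by linarith
  have h := Real.cos_le_one_sub_mul_cos_sq hθπ
  have hπ2 : Real.pi ^ 2 < 10 := by
    have h315 := Real.pi_lt_d2
    nlinarith [Real.pi_pos]
  have h15 : (1 : ℝ) / 5 ≤ 2 / Real.pi ^ 2 := by
    rw [div_le_div_iff₀ (by norm_num) (by positivity)]; nlinarith
  have := mul_le_mul_of_nonneg_right h15 (sq_nonneg θ)
  linarith

/-! ### The stub -/

/-- **Stub `stub_shiftedBoxWeightLower` (registered signature, verbatim).**  Dirichlet-kernel lower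
bound for the Fourier weight of the shifted-box test vector `v = 𝟙_{Λ_R} − 𝟙_{Λ_R + y}`,
`‖y‖∞ ≤ R`, `R ≥ 1`, `|k_j| ≤ 1/(2R+1)`:
`Σ_{x,x'} v_x v_{x'} cos k·(x'−x) = 2 (∏_j D_R(k_j))² (1 − cos k·y) ≥ ((2R+1)⁶/64)·(2/5)(k·y)²`.
[folklore] -/
theorem stub_shiftedBoxWeightLower :
    ∀ (R : ℕ) (y : Site 3) (k : Fin 3 → ℝ), 1 ≤ R → Site.supNorm y ≤ R → (∀ j, |k j| ≤ 1 / (2 * (R : ℝ) + 1)) →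
      ((2 * (R : ℝ) + 1) ^ 6 / 64) * ((2 / 5) * (phase 3 k y) ^ 2) ≤
        ∑ x ∈ (box 3 R ∪ (box 3 R).image (· + y)), ∑ x' ∈ (box 3 R ∪ (box 3 R).image (· + y)),
          ((if x ∈ box 3 R then (1 : ℝ) else 0) - (if x - y ∈ box 3 R then (1 : ℝ) else 0)) * ((if x' ∈ box 3 R then (1 : ℝ) else 0) - (if x' - y ∈ box 3 R then (1 : ℝ) else 0)) * Real.cos (phase 3 k (x' - x)) := by
  intro R y k _ hy hk
  rw [shiftedBoxWeight_eq]
  have hψ := shiftedBoxWeight_prod_dirichletRowSum_sq_ge R hk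
  have hθ := shiftedBoxWeight_sq_div_five_le_one_sub_cos (shiftedBoxWeight_abs_phase_le R hy hk)
  calc (2 * (R : ℝ) + 1) ^ 6 / 64 * (2 / 5 * phase 3 k y ^ 2)
      = 2 * ((2 * (R : ℝ) + 1) ^ 6 / 64) * (phase 3 k y ^ 2 / 5) := by ring
    _ ≤ 2 * (∏ j, dirichletRowSum R (k j)) ^ 2 * (1 - Real.cos (phase 3 k y)) :=
      mul_le_mul (mul_le_mul_of_nonneg_left hψ two_pos.le) hθ (by positivity) (by positivity)

end Summit.CriticalPhenomena.Ising3DConformalLimit.Cruxes.DirectCorrelationStableTail.DiffusiveBranchIsNonsaturation
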